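import Summits.CriticalPhenomena.PercolationContinuityZ3.Theorems.FK.RegionLawMonotone
import Summits.CriticalPhenomena.PercolationContinuityZ3.Theorems.FK.InfiniteVolumeMonotone
import Summits.CriticalPhenomena.PercolationContinuityZ3.Theorems.FK.InfiniteVolumeClosedBoundaryFree
import HarnessLib

/-!
# FK-continuity cell, FO-10a: Grimmett 2006, Thm. (4.19)(a) AS PRINTED — the region laws `φ^b_{Λ,p,q}(A)` converge to
# `φ^b_{p,q}(A)` as `Λ ↑ ℤ^d` along the DIRECTED SET of all finite regions (not only along the boxes `Λ_n`)

Registered R97 (cell INBOX l.6718, 2026-08-24); registry row FO-10a-g339l; label RLL-A (coordinator fk-4 g200).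
Cell `fk-continuity` (bschramm), row FO-10a (domain-Markov + comparison layer over FO-06); support file for the
FK-continuity transplant (`--supports stmt-CriticalPhenomena-4575`); builds on p205010 (kernel theorem, internal audit
signed; external expert review pending). Pure proofs; no definitions, no named facts, no sorries; general `d` (`d ≥ 1`
where the wired law is concerned).
UNCONDITIONAL infinite-volume structure; it decides nothing about FH / TP_FK / the value of `p_c(q)`.

Grimmett 2006, Thm. (4.19)(a): "Let `p ∈ [0,1]`, `q ∈ [1,∞)`. The limits `φ^b_{p,q} = lim_{Λ↑ℤ^d} φ^b_{Λ,p,q}`, `b = 0,1`, exist."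
The tree defines `φ^b_{p,q} = rcLimit d b p q` through the boxes `Λ_n = [-n,n]^d` (`IsBoxLimit`, FO-06); this file records
the printed net statement: for every increasing (or decreasing) local event `A`, `Λ ↦ φ⁰_{Λ,p,q}(A)`
(`regionFreeReal d p q Λ A`, free region law of FO-06 `InfiniteVolumeGibbs.lean`) converges to `φ⁰_{p,q}(A)` along
`atTop : Filter (Finset (Site d))` (regions directed by inclusion), and likewise `φ¹_{Λ,p,q}(A) → φ¹_{p,q}(A)`. Proof =
Grimmett's (4.24): monotonicity in the region on increasing events (`regionFreeReal_mono`, `regionWiredReal_anti`,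
`RegionLawMonotone.lean`) sandwiches every region between two boxes.

* `regionFreeReal_le_rcLimit_real`, `rcLimit_real_le_regionWiredReal` — `φ⁰_{Λ,p,q}(A) ≤ φ⁰_{p,q}(A)` and
  `φ¹_{p,q}(A) ≤ φ¹_{Λ,p,q}(A)` for EVERY finite region (increasing local `A`; for the wired bound `A` determined inside `Λ`);
* **`tendsto_regionFreeReal_atTop`**, **`tendsto_regionWiredReal_atTop`** — Thm. (4.19)(a) along the directed set of
  regions, increasing local events; `…_of_isLowerSet` — the decreasing local events (complements);
* `tendsto_regionFreeReal_comp_of_tendsto_atTop`, `tendsto_regionWiredReal_comp_of_tendsto_atTop` — along every sequence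
  of regions `Λ_n → atTop` (i.e. eventually containing each finite set; e.g. van Hove sequences, shifted boxes, …).

Honest framing: infinite-volume bookkeeping; no statement about `p_c(q)`; NOT a binder discharge, NOT `_r4`.

## References

* G. Grimmett, *The Random-Cluster Model*, Springer 2006 (`book:grimmett2006-random-cluster-model`): Thm. (4.19)(a) and
  its proof, eq. (4.24), Lemma (4.14) [PDF pp. 77–79]. [Grimmett2006]
-/

noncomputable section

open Finset Filter Topology MeasureTheory

namespace Summit.CriticalPhenomena.PercolationContinuityZ3.Theorems.FK

open Literature.Probability.Percolation Literature.Probability.LatticeModels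

variable {d : ℕ}

/-! ### Every region law is bounded by the infinite-volume measure -/

/-- **`φ⁰_{Λ,p,q}(A) ≤ φ⁰_{p,q}(A)`** for every finite region `Λ ⊆ ℤ^d` and every increasing local event `A`
(`p ∈ [0,1]`, `q ≥ 1`): `Λ ⊆ Λ_N`, the free law increases with the region, and `φ⁰_{Λ_N} ≤ φ⁰`.
[cite: Grimmett2006, Thm. (4.19)(a), proof, eq. (4.24)] -/
theorem regionFreeReal_le_rcLimit_real {p q : ℝ} (hp : p ∈ Set.Icc (0 : ℝ) 1) (hq : 1 ≤ q)
    {A : Set (BondConfig (Site d))} (hA : IsLocalEvent A) (hAu : IsUpperSet A) (Λ : Finset (Site d)) :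
    regionFreeReal d p q Λ A ≤ (rcLimit d false p q).real A := by
  obtain ⟨N, hN⟩ : ∃ N : ℕ, Λ ⊆ box d N :=
    ⟨Λ.sup siteRad, fun _ hx => mem_box_iff_siteRad_le.2 (Finset.le_sup (f := siteRad) hx)⟩
  calc regionFreeReal d p q Λ A ≤ regionFreeReal d p q (box d N) A := regionFreeReal_mono hp hq hN hAu
    _ = (rcBoxLaw d false p q N).real A := regionFreeReal_box p q N (measurableSet_of_isLocalEvent_holds hA)
    _ ≤ (rcLimit d false p q).real A := rcBoxLaw_real_le_rcLimit hp hq hA hAu N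

/-- **`φ¹_{p,q}(A) ≤ φ¹_{Λ,p,q}(A)`** for every finite region `Λ ⊆ ℤ^d` (`d ≥ 1`) and every increasing event `A` determined
by the edges `E_{Λ₀}` of a sub-region `Λ₀ ⊆ Λ` (`p ∈ [0,1]`, `q ≥ 1`): `Λ ⊆ Λ_N`, the wired law decreases with the region,
and `φ¹ ≤ φ¹_{Λ_N}`. [cite: Grimmett2006, Thm. (4.19)(a), proof, eq. (4.24)] -/
theorem rcLimit_real_le_regionWiredReal (hd : 0 < d) {p q : ℝ} (hp : p ∈ Set.Icc (0 : ℝ) 1) (hq : 1 ≤ q)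
    {A : Set (BondConfig (Site d))} {Λ₀ Λ : Finset (Site d)} (hA : DeterminedBy A ↑(edgesIn (zdGraph d) Λ₀))
    (hAu : IsUpperSet A) (hΛ : Λ₀ ⊆ Λ) :
    (rcLimit d true p q).real A ≤ regionWiredReal d p q Λ A := by
  obtain ⟨N, hN⟩ : ∃ N : ℕ, Λ ⊆ box d N :=
    ⟨Λ.sup siteRad, fun _ hx => mem_box_iff_siteRad_le.2 (Finset.le_sup (f := siteRad) hx)⟩
  have hAΛ : DeterminedBy A ↑(edgesIn (zdGraph d) Λ) :=
    hA.mono (edgesIn_subset_edgesIn_of_subset hΛ)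
  have hF : ∀ e ∈ edgesIn (zdGraph d) Λ₀, ∀ z ∈ e, z ∈ box d N :=
    fun e he z hz => hN (hΛ ((mem_edgesIn_iff.1 he).2 z hz))
  calc (rcLimit d true p q).real A ≤ (rcBoxLaw d true p q N).real A := rcLimit_real_le_rcBoxLaw hd hp hq hA hAu hF
    _ = regionWiredReal d p q (box d N) A := (regionWiredReal_box p q N hA.measurableSet_of_finset).symm
    _ ≤ regionWiredReal d p q Λ A := regionWiredReal_anti hp hq hN hAu hAΛ

/-! ### Thm. (4.19)(a) along the directed set of regions -/

/-- **Grimmett 2006, Thm. (4.19)(a), free boundary condition, as printed**: for `p ∈ [0,1]`, `q ≥ 1` and every increasing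
local event `A`, `φ⁰_{Λ,p,q}(A) → φ⁰_{p,q}(A)` as `Λ ↑ ℤ^d` along the directed set of all finite regions
(`atTop : Filter (Finset (Site d))`). [cite: Grimmett2006, Thm. (4.19)(a)] -/
theorem tendsto_regionFreeReal_atTop {p q : ℝ} (hp : p ∈ Set.Icc (0 : ℝ) 1) (hq : 1 ≤ q)
    {A : Set (BondConfig (Site d))} (hA : IsLocalEvent A) (hAu : IsUpperSet A) :
    Tendsto (fun Λ : Finset (Site d) => regionFreeReal d p q Λ A) atTop (𝓝 ((rcLimit d false p q).real A)) := by
  have hbox := (isBoxLimit_rcLimit false hp hq (d := d)).tendsto_real hA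
  have hAm : MeasurableSet A := measurableSet_of_isLocalEvent_holds hA
  rw [tendsto_order]
  refine ⟨fun a ha => ?_, fun b hb => Eventually.of_forall fun Λ => (regionFreeReal_le_rcLimit_real hp hq hA hAu Λ).trans_lt hb⟩
  obtain ⟨n, hn⟩ := ((tendsto_order.1 hbox).1 a ha).exists
  filter_upwards [eventually_ge_atTop (box d n)] with Λ hΛ
  calc a < (rcBoxLaw d false p q n).real A := hn
    _ = regionFreeReal d p q (box d n) A := (regionFreeReal_box p q n hAm).symm
    _ ≤ regionFreeReal d p q Λ A := regionFreeReal_mono hp hq hΛ hAu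

/-- **Grimmett 2006, Thm. (4.19)(a), wired boundary condition, as printed**: for `d ≥ 1`, `p ∈ [0,1]`, `q ≥ 1` and every
increasing event `A` determined by the edges of a finite region `Λ₀`, `φ¹_{Λ,p,q}(A) → φ¹_{p,q}(A)` as `Λ ↑ ℤ^d` along the
directed set of all finite regions. [cite: Grimmett2006, Thm. (4.19)(a)] -/
theorem tendsto_regionWiredReal_atTop (hd : 0 < d) {p q : ℝ} (hp : p ∈ Set.Icc (0 : ℝ) 1) (hq : 1 ≤ q)
    {A : Set (BondConfig (Site d))} {Λ₀ : Finset (Site d)} (hA : DeterminedBy A ↑(edgesIn (zdGraph d) Λ₀))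
    (hAu : IsUpperSet A) :
    Tendsto (fun Λ : Finset (Site d) => regionWiredReal d p q Λ A) atTop (𝓝 ((rcLimit d true p q).real A)) := by
  have hAl : IsLocalEvent A := ⟨_, hA⟩
  have hbox := (isBoxLimit_rcLimit true hp hq (d := d)).tendsto_real hAl
  have hAm : MeasurableSet A := hA.measurableSet_of_finset
  obtain ⟨N₀, hN₀⟩ : ∃ N : ℕ, Λ₀ ⊆ box d N :=
    ⟨Λ₀.sup siteRad, fun _ hx => mem_box_iff_siteRad_le.2 (Finset.le_sup (f := siteRad) hx)⟩
  rw [tendsto_order]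
  refine ⟨fun a ha => ?_, fun b hb => ?_⟩
  · filter_upwards [eventually_ge_atTop Λ₀] with Λ hΛ
    exact ha.trans_le (rcLimit_real_le_regionWiredReal hd hp hq hA hAu hΛ)
  · obtain ⟨n, hn, hnb⟩ := ((eventually_ge_atTop N₀).and ((tendsto_order.1 hbox).2 b hb)).exists
    have hΛ₀n : Λ₀ ⊆ box d n := hN₀.trans (box_mono d hn)
    have hAn : DeterminedBy A ↑(edgesIn (zdGraph d) (box d n)) :=
      hA.mono (edgesIn_subset_edgesIn_of_subset hΛ₀n)
    filter_upwards [eventually_ge_atTop (box d n)] with Λ hΛ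
    calc regionWiredReal d p q Λ A ≤ regionWiredReal d p q (box d n) A := regionWiredReal_anti hp hq hΛ hAu hAn
      _ = (rcBoxLaw d true p q n).real A := regionWiredReal_box p q n hAm
      _ < b := hnb

/-! ### Decreasing local events -/

/-- The free region laws of a DECREASING local event converge to `φ⁰_{p,q}` along the directed set of regions
(complements). [cite: Grimmett2006, Thm. (4.19)(a)] -/
theorem tendsto_regionFreeReal_atTop_of_isLowerSet {p q : ℝ} (hp : p ∈ Set.Icc (0 : ℝ) 1) (hq : 1 ≤ q)
    {A : Set (BondConfig (Site d))} (hA : IsLocalEvent A) (hAl : IsLowerSet A) :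
    Tendsto (fun Λ : Finset (Site d) => regionFreeReal d p q Λ A) atTop (𝓝 ((rcLimit d false p q).real A)) := by
  have hq0 : 0 < q := one_pos.trans_le hq
  haveI := isProbabilityMeasure_rcLimit (d := d) false p q
  have hAm : MeasurableSet A := measurableSet_of_isLocalEvent_holds hA
  have hc := tendsto_regionFreeReal_atTop hp hq hA.compl hAl.compl
  have e1 : ∀ Λ, regionFreeReal d p q Λ A = 1 - regionFreeReal d p q Λ Aᶜ := fun Λ => by
    rw [regionFreeReal_compl hp hq0 Λ hAm]; ring
  have e2 : (rcLimit d false p q).real A = 1 - (rcLimit d false p q).real Aᶜ := by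
    rw [measureReal_compl hAm, probReal_univ]; ring
  simp_rw [e1, e2]
  exact tendsto_const_nhds.sub hc

/-- The wired region laws of a DECREASING event determined by `E_{Λ₀}` converge to `φ¹_{p,q}` along the directed set of
regions (complements; `d ≥ 1`). [cite: Grimmett2006, Thm. (4.19)(a)] -/
theorem tendsto_regionWiredReal_atTop_of_isLowerSet (hd : 0 < d) {p q : ℝ} (hp : p ∈ Set.Icc (0 : ℝ) 1) (hq : 1 ≤ q)
    {A : Set (BondConfig (Site d))} {Λ₀ : Finset (Site d)} (hA : DeterminedBy A ↑(edgesIn (zdGraph d) Λ₀))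
    (hAl : IsLowerSet A) :
    Tendsto (fun Λ : Finset (Site d) => regionWiredReal d p q Λ A) atTop (𝓝 ((rcLimit d true p q).real A)) := by
  have hq0 : 0 < q := one_pos.trans_le hq
  haveI := isProbabilityMeasure_rcLimit (d := d) true p q
  have hAm : MeasurableSet A := hA.measurableSet_of_finset
  have hc := tendsto_regionWiredReal_atTop hd hp hq hA.compl hAl.compl
  have e1 : ∀ Λ, regionWiredReal d p q Λ A = 1 - regionWiredReal d p q Λ Aᶜ := fun Λ => by
    rw [regionWiredReal_compl hp hq0 Λ hAm]; ring
  have e2 : (rcLimit d true p q).real A = 1 - (rcLimit d true p q).real Aᶜ := by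
    rw [measureReal_compl hAm, probReal_univ]; ring
  simp_rw [e1, e2]
  exact tendsto_const_nhds.sub hc

/-! ### Along sequences of regions -/

/-- **Along every exhausting sequence of regions**: if `Λ_n → atTop` in `Finset (Site d)` (every finite set is eventually
contained in `Λ_n` — van Hove sequences, shifted boxes, …) then `φ⁰_{Λ_n,p,q}(A) → φ⁰_{p,q}(A)` for every increasing local
event `A`. [cite: Grimmett2006, Thm. (4.19)(a)] -/
theorem tendsto_regionFreeReal_comp_of_tendsto_atTop {ι : Type*} {l : Filter ι} {Λs : ι → Finset (Site d)}
    (hΛ : Tendsto Λs l atTop) {p q : ℝ} (hp : p ∈ Set.Icc (0 : ℝ) 1) (hq : 1 ≤ q)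
    {A : Set (BondConfig (Site d))} (hA : IsLocalEvent A) (hAu : IsUpperSet A) :
    Tendsto (fun i => regionFreeReal d p q (Λs i) A) l (𝓝 ((rcLimit d false p q).real A)) :=
  (tendsto_regionFreeReal_atTop hp hq hA hAu).comp hΛ

/-- The wired twin along exhausting sequences of regions (`d ≥ 1`). [cite: Grimmett2006, Thm. (4.19)(a)] -/
theorem tendsto_regionWiredReal_comp_of_tendsto_atTop {ι : Type*} {l : Filter ι} {Λs : ι → Finset (Site d)}
    (hΛ : Tendsto Λs l atTop) (hd : 0 < d) {p q : ℝ} (hp : p ∈ Set.Icc (0 : ℝ) 1) (hq : 1 ≤ q)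
    {A : Set (BondConfig (Site d))} {Λ₀ : Finset (Site d)} (hA : DeterminedBy A ↑(edgesIn (zdGraph d) Λ₀))
    (hAu : IsUpperSet A) :
    Tendsto (fun i => regionWiredReal d p q (Λs i) A) l (𝓝 ((rcLimit d true p q).real A)) :=
  (tendsto_regionWiredReal_atTop hd hp hq hA hAu).comp hΛ

end Summit.CriticalPhenomena.PercolationContinuityZ3.Theorems.FK
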